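import Summits.NavierStokesRegularity.FluidComputer.ClayBlowupLocalAlignment
import HarnessLib

/-!
# THE VELOCITY ALONE REACHES THE TYPE I SCALE NEAR EVERY SINGULAR POINT, WITH THE CLAY FORCE:
# no singular point of a Clay blow-up is locally sub-Type-I

Cell `ns-blowup`, seat `ns-blowup-ecbridge-2` (g11; the E–C endpoint theory seat). LABEL: E–C typing
(KERNEL — no named fact, no new definition). WHAT THIS IS NOT: not Navier–Stokes evidence — a
necessary condition on the TYPE `ClayBlowup ν` with its Clay force; no inhabitant is claimed.
Companion memo: `run/shared/lean/pub/ns-blowup/ecbridge2/ECBRIDGE-2-MEMO-10.md`.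

## Content

Leray's rate `‖u(t)‖_∞ ≥ c√ν/√(T − t)` (tree: `not_subTypeI`, `forced_leray_rate_sup`) is a GLOBAL
statement, and g6's local row `selfSimilar_scale_attained` has a pressure alternative. The local zoom
at a prescribed singular point gives a purely LOCAL, VELOCITY-ONLY row: if `‖u(t, x)‖ ≤ ε/√(T − t)`
held near `T` on a ball `B(x₁, r₀)` for EVERY `ε > 0`, the local zoom limit `W` at `x₁` would satisfy
`√(−s)‖W(s, z)‖ ≤ ε` for every `ε`, i.e. vanish on `s < 0` — against `‖W(−σ₁/2, 0)‖ ≥ 1/2`.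

* `ClayBlowup.not_local_subTypeI_one` (`ν = 1`) and **`ClayBlowup.not_local_subTypeI`** (every
  `ν > 0`): at a point `x₁` which is not backward bounded, for every `r₀ > 0`,
  `¬ ∀ ε > 0, ∀ᶠ t ↑ T, ∀ x ∈ B(x₁, r₀), ‖u(t, x)‖ ≤ ε/√(T − t)`.
* **`ClayBlowup.exists_local_typeI_scale`** — there is `ε > 0` such that for every `t₀ < T` some
  `t ∈ (t₀, T)` and `x ∈ B(x₁, r₀)` have `‖u(t, x)‖ > ε/√(T − t)`; `DesignedBlowup` twin.

References: Koch–Nadirashvili–Seregin–Šverák, Acta Math. 203 (2009), Prop 6.1 and §1; J. Leray, Acta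
Math. 63 (1934), (3.16) [cite: KochNadirashviliSereginSverak2009, Prop 6.1] [cite: Leray1934, (3.16)];
C. L. Fefferman, (C) [cite: FeffermanClay2006, (C)].
-/

noncomputable section

namespace Summit.NavierStokesRegularity.FluidComputer

open Set MeasureTheory Filter Topology Function Metric
open scoped ENNReal NNReal
open Literature.Analysis Literature.Analysis.FluidPDE
open Summit.NavierStokesRegularity.NavierStokesRegularity

namespace ClayBlowup

/-- **NO SINGULAR POINT IS LOCALLY SUB-TYPE-I (`ν = 1`, ANY Clay force; no named fact)**: at a point
`x₁` which is not backward bounded, the bounds `‖u(t, x)‖ ≤ ε/√(T − t)` near `T` on `B(x₁, r₀)`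
cannot hold for every `ε > 0`. The local zoom with force; the bounds pass to the limit, which would
vanish. [cite: KochNadirashviliSereginSverak2009, Prop 6.1] [cite: Leray1934, (3.16)] -/
theorem not_local_subTypeI_one (Y : ClayBlowup 1) {x₁ : EuclideanSpace ℝ (Fin 3)}
    (hx₁ : ¬ IsBackwardBoundedAt Y.u Y.T x₁) {r₀ : ℝ} (hr₀ : 0 < r₀) :
    ¬ ∀ ε : ℝ, 0 < ε → ∀ᶠ t in 𝓝[<] Y.T, ∀ x ∈ ball x₁ r₀,
      ‖Y.u t x‖ ≤ ε / Real.sqrt (Y.T - t) := by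
  intro hε
  have hT := Y.T_pos
  -- ### the local zoom at `x₁`
  have hr' : 0 < min 1 (r₀ / 2) := lt_min one_pos (by positivity)
  have ht_b : Y.T / 2 ∈ Ico 0 Y.T := ⟨by positivity, by linarith⟩
  obtain ⟨t, x, φ, W, hφ, ht, hx, hk1, -, -, -, -, ⟨σ₁, hσ₁, hhalf⟩, hconv⟩ :=
    Y.exists_local_zoom_limit hx₁ hr' (min_le_left _ _) ht_b
  obtain ⟨c, hc⟩ : ∃ c : ℕ → ℝ, ∀ k, c k = ‖Y.u (t k) (x k)‖⁻¹ := ⟨_, fun k => rfl⟩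
  simp_rw [← hc] at hconv
  have hM0 : ∀ k, 0 < ‖Y.u (t k) (x k)‖ := fun k => lt_of_lt_of_le (by positivity) (hk1 k)
  have hc0 : ∀ k, 0 < c k := fun k => by rw [hc k]; exact inv_pos.2 (hM0 k)
  have htI : ∀ k, t k ∈ Ioo 0 Y.T := fun k => ⟨lt_of_lt_of_le (by positivity) (ht k).1, (ht k).2⟩
  have hxr : ∀ k, dist (x k) x₁ < r₀ / 2 := fun k =>
    lt_of_lt_of_le (mem_ball.1 (hx k)) (min_le_right _ _)
  -- ### slice times → T⁻, amplitudes → 0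
  have htT : Tendsto t atTop (𝓝[<] Y.T) := Y.tendsto_of_norm_ge one_pos htI hk1
  have hcto : Tendsto c atTop (𝓝 0) := by
    have hMto : Tendsto (fun k => ‖Y.u (t k) (x k)‖) atTop atTop := by
      refine tendsto_atTop_atTop.2 fun B => ⟨⌈B⌉₊, fun k hk => ?_⟩
      have h1 : (⌈B⌉₊ : ℝ) ≤ k := by exact_mod_cast hk
      linarith [Nat.le_ceil B, hk1 k]
    exact (tendsto_inv_atTop_zero.comp hMto).congr fun k => by simp [Function.comp, hc k]
  have htime : ∀ s ≤ 0, Tendsto (fun j => t (φ j) + c (φ j) ^ 2 * s) atTop (𝓝[<] Y.T) := by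
    intro s hs
    have h1 : Tendsto (fun j => t (φ j)) atTop (𝓝 Y.T) :=
      (tendsto_nhdsWithin_iff.1 htT).1.comp hφ.tendsto_atTop
    have h2 : Tendsto (fun j => c (φ j) ^ 2 * s) atTop (𝓝 0) := by
      simpa using ((hcto.comp hφ.tendsto_atTop).pow 2).mul_const s
    refine tendsto_nhdsWithin_iff.2 ⟨by simpa using h1.add h2, Eventually.of_forall fun j => ?_⟩
    have : c (φ j) ^ 2 * s ≤ 0 := mul_nonpos_of_nonneg_of_nonpos (sq_nonneg _) hs
    exact lt_of_le_of_lt (by linarith) (ht (φ j)).2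
  have hsqrt : ∀ s ≤ 0, ∀ j, c (φ j) * Real.sqrt (-s) ≤
      Real.sqrt (Y.T - (t (φ j) + c (φ j) ^ 2 * s)) := by
    intro s hs j
    have e1 : c (φ j) * Real.sqrt (-s) = Real.sqrt (c (φ j) ^ 2 * -s) := by
      rw [Real.sqrt_mul (sq_nonneg _), Real.sqrt_sq (hc0 _).le]
    rw [e1]
    refine Real.sqrt_le_sqrt ?_
    have e2 : c (φ j) ^ 2 * -s = -(c (φ j) ^ 2 * s) := by ring
    rw [e2]
    linarith [(ht (φ j)).2]
  have hsmall : ∀ A : ℝ, ∀ᶠ j in atTop, c (φ j) * A < r₀ / 4 := fun A => by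
    have h : Tendsto (fun j => c (φ j) * A) atTop (𝓝 (0 * A)) :=
      (hcto.comp hφ.tendsto_atTop).mul_const A
    rw [zero_mul] at h
    exact h.eventually (gt_mem_nhds (by positivity))
  have hball : ∀ j (z : EuclideanSpace ℝ (Fin 3)), c (φ j) * ‖z‖ < r₀ / 2 →
      x (φ j) + c (φ j) • z ∈ ball x₁ r₀ := by
    intro j z hz
    rw [mem_ball, dist_eq_norm]
    have e : x (φ j) + c (φ j) • z - x₁ = (x (φ j) - x₁) + c (φ j) • z := by abel
    rw [e]
    have h1 : ‖x (φ j) - x₁‖ < r₀ / 2 := by rw [← dist_eq_norm]; exact hxr _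
    have h2 : ‖c (φ j) • z‖ < r₀ / 2 := by
      rwa [norm_smul, Real.norm_of_nonneg (hc0 _).le]
    linarith [norm_add_le (x (φ j) - x₁) (c (φ j) • z)]
  -- ### every bound passes to the limit: `√(−s) ‖W(s, z)‖ ≤ ε` for every `ε > 0`
  have hIW : ∀ ε : ℝ, 0 < ε → ∀ s < 0, ∀ z, Real.sqrt (-s) * ‖W s z‖ ≤ ε := by
    intro ε hε0 s hs z
    have hs0 : 0 < Real.sqrt (-s) := Real.sqrt_pos.2 (by linarith)
    refine le_of_tendsto (((hconv s hs z).norm).const_mul _) ?_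
    filter_upwards [(htime s hs.le).eventually (hε ε hε0), hsmall ‖z‖] with j hj hjz
    rw [norm_smul, Real.norm_of_nonneg (hc0 (φ j)).le]
    have h1 := hj (x (φ j) + c (φ j) • z) (hball j z (by linarith))
    have h2 := hsqrt s hs.le j
    have hTt : 0 < Real.sqrt (Y.T - (t (φ j) + c (φ j) ^ 2 * s)) :=
      lt_of_lt_of_le (mul_pos (hc0 _) hs0) h2
    have hcφ : 0 ≤ c (φ j) := (hc0 _).le
    calc Real.sqrt (-s) * (c (φ j) * ‖Y.u (t (φ j) + c (φ j) ^ 2 * s) (x (φ j) + c (φ j) • z)‖)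
        ≤ Real.sqrt (-s) * (c (φ j) * (ε / Real.sqrt (Y.T - (t (φ j) + c (φ j) ^ 2 * s)))) := by
          gcongr
      _ = ε * (c (φ j) * Real.sqrt (-s) / Real.sqrt (Y.T - (t (φ j) + c (φ j) ^ 2 * s))) := by
          ring
      _ ≤ ε * 1 := by
          gcongr
          rw [div_le_one hTt]; exact h2
      _ = ε := mul_one ε
  -- ### hence `W ≡ 0` on `s < 0`, against the nontriviality near the vertex
  have hzero : ∀ s < 0, ∀ z, W s z = 0 := by
    intro s hs z
    have hs0 : 0 < Real.sqrt (-s) := Real.sqrt_pos.2 (by linarith)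
    have h0 : Real.sqrt (-s) * ‖W s z‖ ≤ 0 :=
      le_of_forall_pos_le_add fun ε hε => by linarith [hIW ε hε s hs z]
    have h1 : ‖W s z‖ ≤ 0 := by
      by_contra h
      push Not at h
      linarith [mul_pos hs0 h]
    exact norm_le_zero_iff.1 h1
  have h := hhalf (-(σ₁ / 2)) ⟨by linarith, by linarith⟩
  rw [hzero _ (by linarith), norm_zero] at h
  linarith

/-- **NO SINGULAR POINT IS LOCALLY SUB-TYPE-I, WITH THE CLAY FORCE** (`μ > 0`; no named fact): at a
point `x₁` which is not backward bounded at `T`, for every `r₀ > 0` the bounds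
`‖u(t, x)‖ ≤ ε/√(T − t)` near `T` on `B(x₁, r₀)` fail for SOME `ε > 0` (viscosity normalisation:
`isBackwardBoundedAt_of_rescale`, `eventually_localTypeI_rescale`).
[cite: KochNadirashviliSereginSverak2009, Prop 6.1] [cite: Leray1934, (3.16)] -/
theorem not_local_subTypeI {μ : ℝ} (X : ClayBlowup μ) (hμ : 0 < μ) {x₁ : EuclideanSpace ℝ (Fin 3)}
    (hx₁ : ¬ IsBackwardBoundedAt X.u X.T x₁) {r₀ : ℝ} (hr₀ : 0 < r₀) :
    ¬ ∀ ε : ℝ, 0 < ε → ∀ᶠ t in 𝓝[<] X.T, ∀ x ∈ ball x₁ r₀,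
      ‖X.u t x‖ ≤ ε / Real.sqrt (X.T - t) := by
  intro hε
  set a : ℝ := 1 / μ with ha
  have ha0 : 0 < a := by positivity
  have hfac : 0 < a / Real.sqrt a := by positivity
  refine (X.rescale hμ one_pos).not_local_subTypeI_one
    (fun h => hx₁ (X.isBackwardBoundedAt_of_rescale hμ one_pos h)) hr₀ fun ε hε0 => ?_
  -- the bound with constant `ε / (a/√a)` for `X` becomes the bound with constant `ε` for `Y`
  have h := X.eventually_localTypeI_rescale hμ one_pos (hε (ε / (a / Real.sqrt a)) (by positivity))
  have e : (1 : ℝ) / μ / Real.sqrt (1 / μ) * (ε / (a / Real.sqrt a)) = ε := by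
    rw [← ha]; field_simp
  rw [e] at h
  exact h

/-- **THE VELOCITY ALONE REACHES THE TYPE I SCALE IN EVERY NEIGHBOURHOOD OF EVERY SINGULAR POINT,
WITH THE CLAY FORCE** (`μ > 0`; no named fact): there is `ε > 0` such that for every `t₀ < T` some
`t ∈ (t₀, T)` and `x ∈ B(x₁, r₀)` satisfy `‖u(t, x)‖ > ε/√(T − t)`.
[cite: KochNadirashviliSereginSverak2009, Prop 6.1] [cite: Leray1934, (3.16)] -/
theorem exists_local_typeI_scale {μ : ℝ} (X : ClayBlowup μ) (hμ : 0 < μ)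
    {x₁ : EuclideanSpace ℝ (Fin 3)} (hx₁ : ¬ IsBackwardBoundedAt X.u X.T x₁) {r₀ : ℝ} (hr₀ : 0 < r₀) :
    ∃ ε : ℝ, 0 < ε ∧ ∀ t₀ < X.T, ∃ t ∈ Ioo t₀ X.T, ∃ x ∈ ball x₁ r₀,
      ε / Real.sqrt (X.T - t) < ‖X.u t x‖ := by
  by_contra hcon
  push Not at hcon
  refine X.not_local_subTypeI hμ hx₁ hr₀ fun ε hε => ?_
  obtain ⟨t₀, ht₀, hle⟩ := hcon ε hε
  filter_upwards [Ioo_mem_nhdsLT ht₀] with t ht x hx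
  exact hle t ht x hx

end ClayBlowup

/-- **The velocity of a designed blow-up reaches the Type I scale near every singular point, with its
force.** [cite: KochNadirashviliSereginSverak2009, Prop 6.1] [cite: Leray1934, (3.16)] -/
theorem DesignedBlowup.exists_local_typeI_scale {ν : ℝ} (D : DesignedBlowup ν) (hν : 0 < ν)
    {x₁ : EuclideanSpace ℝ (Fin 3)} (hx₁ : ¬ IsBackwardBoundedAt D.u D.T x₁) {r₀ : ℝ} (hr₀ : 0 < r₀) :
    ∃ ε : ℝ, 0 < ε ∧ ∀ t₀ < D.T, ∃ t ∈ Ioo t₀ D.T, ∃ x ∈ ball x₁ r₀,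
      ε / Real.sqrt (D.T - t) < ‖D.u t x‖ :=
  D.toClayBlowup.exists_local_typeI_scale hν hx₁ hr₀

end Summit.NavierStokesRegularity.FluidComputer

end
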